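import Summits.QuantumFields.BalabanUV.Beta.EriceFlowEnclosureInverseLawThird

/-!
# Beta / EriceFlowEnclosureInverseLawFourthStep — INVERSION OF A LOGARITHMIC LAW TO FOURTH ORDER, THE ALGEBRA (pure real analysis,
# SERVICE): the exact rearrangement and the remainder bounds behind P2 #36e `…InverseLawFourth.inverse_law_fourth` (the inverse law
# `1∕σ y = y + κ·log y − C + κ²·(log y)∕y − (κC + a)∕y + Q(log y)∕y² + O((1 + log y)³∕y³)`, Q(ℓ) = −(κ³∕2)ℓ² + (κ³ + κ²C + κa)ℓ −
# (κC²∕2 + κ²C + κa + aC + b), of a Λ-law `Λ t = 1∕t + κ·log t + C + a·t + b·t² + O(t³)`), kept in its own file so that every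
# declaration stays inside Lean's default heartbeat budget and both files stay under the 400-line limit (β-flow team, prover 2 = lower ∕
# positivity side, unit `b2b-balaban-beta-bflow-p2`, gen 20; module P2 #36e-A; companion P2 #36c `…InverseLawThird` — one order less, the
# same letters E, u, r and the same device `inverse_third_identity` ∕ `inverse_third_remainder_le`)

HONEST FRAMING (page 1 of everything the β sub-cell writes): discharging `BetaPertH` makes Bałaban's UV stability UNCONDITIONAL — a
real constructive-QFT result; it is NOT the continuum limit and NOT the Clay problem.  HONEST DEPENDENCY (cell reorg 2026-08-19,
verbatim): «continuum YM on T⁴ ⇐ BetaPertH ∧ nine spine estimates (0/9 proved); BetaPertH ⇐ (D1) ∧ (D4) ∧ CAP+tail; G-an2-4 gates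
asym, D1 and NE2/3/4.»  THIS MODULE DISCHARGES NOTHING: [folklore] algebra and inequalities in abstract real letters (Mathlib's
`Real.abs_log_sub_add_sum_range_le` at n = 2 for `|u + u²∕2 + log(1 − u)| ≤ 2|u|³`); no Erice sentence is consumed; κ, C, a, b are
ABSTRACT letters (at the β-flow: κ = β₂∕β₀, C = C_Λ, a = a_Λ, b = b_Λ — OUR letters ∕ bflow-p1's READINGS of (3.76) «+ O(1)», p. 250).

WHAT THIS FILE PROVES (0 sorry, 0 def): `abs_log_sub_sub_le_of_inv_eq` (1∕w = 1 − u, |u| ≤ 1∕2 ⟹ |log w − u − u²∕2| ≤ 2|u|³);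
**`inverse_fourth_identity`** — with E := y − 1∕t − κ log t − C, u := (C + κ log t + E)∕y (so 1∕(y t) = 1 − u), r := log(y t) − u,
u₀ := (C − κ log y)∕y, d := u − u₀, E₄ := E − a t − b t², r₃ := r − u²∕2:
`1∕t − y − κ log y + C − κ²(log y)∕y + (κC + a)∕y − Q(log y)∕y²
   = −κ²d∕y − κ²r∕y − κatu∕y − κbt²∕y − κE₄∕y − κu₀d − κd²∕2 − κr₃ − ad∕y − atu² − btu∕y − bt²u − E₄`
(a `field_simp; ring` identity, checked first in exact rational arithmetic — `HOME/b2b-balaban-beta-bflow-p2/g20/m36e/check_identity4.py`);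
`inverse_fourth_remainder_le₁` ∕ `inverse_fourth_remainder_le₂` (the six- and seven-term bounds by constants × L³∕y³ under |u|, |u₀| ≤ BL∕y,
|r| ≤ 2B²L²∕y², |d| ≤ D₁L²∕y², |r₃| ≤ 2B³L³∕y³, |E₄| ≤ 8A∕y³, 0 < t ≤ 2∕y, 1 ≤ L ≤ y, y ≥ 2).
NOT CLAIMED: anything asymptotic (that is P2 #36e `…InverseLawFourth`); anything about (1.22); `BetaPertH`; continuum; Clay.
-/

namespace Summit.QuantumFields.BalabanUV.Beta.EriceFlowEnclosureInverseLawFourthStep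

open Set Filter Topology

noncomputable section

/-- If `1∕w = 1 − u` and `|u| ≤ 1∕2` then `|log w − u − u²∕2| ≤ 2|u|³` (Mathlib `Real.abs_log_sub_add_sum_range_le`, n = 2). [folklore] -/
theorem abs_log_sub_sub_le_of_inv_eq {w u : ℝ} (hinv : 1 / w = 1 - u) (hu : |u| ≤ 1 / 2) :
    |Real.log w - u - u ^ 2 / 2| ≤ 2 * |u| ^ 3 := by
  have hlogw : Real.log w = -Real.log (1 - u) := by
    rw [← hinv, one_div, Real.log_inv, neg_neg]
  have hx : |u| < 1 := by linarith
  have h := Real.abs_log_sub_add_sum_range_le hx 2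
  simp only [Finset.sum_range_succ, Finset.sum_range_zero, Nat.cast_zero, zero_add, pow_one, div_one,
    Nat.cast_one] at h
  have h1 : |u| ^ (2 + 1) / (1 - |u|) ≤ 2 * |u| ^ 3 := by
    rw [show (2:ℕ) + 1 = 3 by norm_num, div_le_iff₀ (by linarith)]
    nlinarith [pow_nonneg (abs_nonneg u) 3]
  have e : Real.log w - u - u ^ 2 / 2 = -(u + u ^ 2 / (1 + 1) + Real.log (1 - u)) := by rw [hlogw]; ring
  rw [e, abs_neg]
  exact h.trans h1

/-- **The exact rearrangement to fourth order** (abstract letters; t, y > 0): with `E := y − 1∕t − κ log t − C`,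
`u := (C + κ log t + E)∕y`, `r := log(y t) − u`, `u₀ := (C − κ log y)∕y`, `d := u − u₀`, `E₄ := E − a t − b t²`, `r₃ := r − u²∕2`:
`1∕t − y − κ log y + C − κ²(log y)∕y + (κC + a)∕y − Q(log y)∕y²` EQUALS the thirteen-term remainder
`−κ²d∕y − κ²r∕y − κatu∕y − κbt²∕y − κE₄∕y − κu₀d − κd²∕2 − κr₃ − ad∕y − atu² − btu∕y − bt²u − E₄`
(uses only 1∕(y t) = 1 − u and log(y t) = log y + log t; `field_simp; ring`). [folklore] -/
theorem inverse_fourth_identity {t y κ C a b E u r u₀ d E₄ r₃ : ℝ} (ht0 : 0 < t) (hy0 : 0 < y)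
    (hE : E = y - 1 / t - κ * Real.log t - C) (hu : u = (C + κ * Real.log t + E) / y)
    (hr : r = Real.log (y * t) - u) (hu₀ : u₀ = (C - κ * Real.log y) / y) (hd : d = u - u₀)
    (hE₄ : E₄ = E - a * t - b * t ^ 2) (hr₃ : r₃ = r - u ^ 2 / 2) :
    1 / t - y - κ * Real.log y + C - κ ^ 2 * Real.log y / y + (κ * C + a) / y
        - (-(κ ^ 3 / 2) * Real.log y ^ 2 + (κ ^ 3 + κ ^ 2 * C + κ * a) * Real.log y
            - (κ * C ^ 2 / 2 + κ ^ 2 * C + κ * a + a * C + b)) / y ^ 2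
      = -(κ ^ 2 * d / y) - κ ^ 2 * r / y - κ * a * t * u / y - κ * b * t ^ 2 / y - κ * E₄ / y - κ * u₀ * d
        - κ * d ^ 2 / 2 - κ * r₃ - a * d / y - a * t * u ^ 2 - b * t * u / y - b * t ^ 2 * u - E₄ := by
  have hlog : Real.log (y * t) = Real.log y + Real.log t := Real.log_mul hy0.ne' ht0.ne'
  subst hd hr₃ hE₄ hu₀
  subst hr
  subst hu
  subst hE
  rw [hlog]
  field_simp
  ring

/-- **Remainder bound, first six terms** (abstract letters): with `y ≥ 2`, `0 < t ≤ 2∕y`, `L ≥ 1`, `B, D₁, A ≥ 0`,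
`|u|, |u₀| ≤ BL∕y`, `|r| ≤ 2B²L²∕y²`, `|d| ≤ D₁L²∕y²`, `|E₄| ≤ 8A∕y³`:
`|−κ²d∕y − κ²r∕y − κatu∕y − κbt²∕y − κE₄∕y − κu₀d| ≤ (κ²D₁ + 2κ²B² + 2|κ||a|B + 4|κ||b| + 4|κ|A + |κ|BD₁)·L³∕y³`. [folklore] -/
theorem inverse_fourth_remainder_le₁ {t y κ a b u r u₀ d E₄ B D₁ A L : ℝ} (hy2 : 2 ≤ y) (ht0 : 0 < t)
    (ht_le : t ≤ 2 / y) (hL1 : 1 ≤ L) (hB0 : 0 ≤ B) (hD0 : 0 ≤ D₁) (hA : 0 ≤ A)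
    (hub : |u| ≤ B * L / y) (hrb : |r| ≤ 2 * B ^ 2 * L ^ 2 / y ^ 2) (hu0b : |u₀| ≤ B * L / y)
    (hdb : |d| ≤ D₁ * L ^ 2 / y ^ 2) (hE₄b : |E₄| ≤ 8 * A / y ^ 3) :
    |-(κ ^ 2 * d / y) - κ ^ 2 * r / y - κ * a * t * u / y - κ * b * t ^ 2 / y - κ * E₄ / y - κ * u₀ * d|
      ≤ (κ ^ 2 * D₁ + 2 * κ ^ 2 * B ^ 2 + 2 * |κ| * |a| * B + 4 * |κ| * |b| + 4 * |κ| * A + |κ| * B * D₁)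
          * (L ^ 3 / y ^ 3) := by
  have hy0 : 0 < y := by linarith
  have hL0 : 0 < L := by linarith
  have hy3 : (0:ℝ) < y ^ 3 := by positivity
  set W : ℝ := L ^ 3 / y ^ 3 with hW
  have hW0 : 0 ≤ W := by positivity
  have hL3 : 1 ≤ L ^ 3 := one_le_pow₀ hL1
  have hLL3 : L ≤ L ^ 3 := by nlinarith [hL1, hL3]
  have hL2L3 : L ^ 2 ≤ L ^ 3 := by nlinarith [hL1]
  have hW1 : 1 / y ^ 3 ≤ W := by rw [hW]; exact div_le_div_of_nonneg_right hL3 hy3.le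
  have hWL : L / y ^ 3 ≤ W := by rw [hW]; exact div_le_div_of_nonneg_right hLL3 hy3.le
  have hWL2 : L ^ 2 / y ^ 3 ≤ W := by rw [hW]; exact div_le_div_of_nonneg_right hL2L3 hy3.le
  have ht2 : t ^ 2 ≤ 4 / y ^ 2 := by
    calc t ^ 2 ≤ (2 / y) ^ 2 := pow_le_pow_left₀ ht0.le ht_le 2
      _ = 4 / y ^ 2 := by rw [div_pow]; norm_num
  -- T1
  have t1 : |κ ^ 2 * d / y| ≤ κ ^ 2 * D₁ * W := by
    rw [abs_div, abs_mul, abs_of_pos hy0, abs_of_nonneg (sq_nonneg κ)]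
    calc κ ^ 2 * |d| / y ≤ κ ^ 2 * (D₁ * L ^ 2 / y ^ 2) / y :=
          div_le_div_of_nonneg_right (mul_le_mul_of_nonneg_left hdb (sq_nonneg κ)) hy0.le
      _ = κ ^ 2 * D₁ * (L ^ 2 / y ^ 3) := by field_simp
      _ ≤ κ ^ 2 * D₁ * W := mul_le_mul_of_nonneg_left hWL2 (by positivity)
  -- T2
  have t2 : |κ ^ 2 * r / y| ≤ 2 * κ ^ 2 * B ^ 2 * W := by
    rw [abs_div, abs_mul, abs_of_pos hy0, abs_of_nonneg (sq_nonneg κ)]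
    calc κ ^ 2 * |r| / y ≤ κ ^ 2 * (2 * B ^ 2 * L ^ 2 / y ^ 2) / y :=
          div_le_div_of_nonneg_right (mul_le_mul_of_nonneg_left hrb (sq_nonneg κ)) hy0.le
      _ = 2 * κ ^ 2 * B ^ 2 * (L ^ 2 / y ^ 3) := by field_simp
      _ ≤ 2 * κ ^ 2 * B ^ 2 * W := mul_le_mul_of_nonneg_left hWL2 (by positivity)
  -- T3
  have t3 : |κ * a * t * u / y| ≤ 2 * |κ| * |a| * B * W := by
    rw [abs_div, abs_mul, abs_mul, abs_mul, abs_of_pos hy0, abs_of_pos ht0]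
    calc |κ| * |a| * t * |u| / y ≤ |κ| * |a| * (2 / y) * (B * L / y) / y := by
          refine div_le_div_of_nonneg_right ?_ hy0.le
          exact mul_le_mul (mul_le_mul_of_nonneg_left ht_le (by positivity)) hub (abs_nonneg u) (by positivity)
      _ = 2 * |κ| * |a| * B * (L / y ^ 3) := by field_simp
      _ ≤ 2 * |κ| * |a| * B * W := mul_le_mul_of_nonneg_left hWL (by positivity)
  -- T4
  have t4 : |κ * b * t ^ 2 / y| ≤ 4 * |κ| * |b| * W := by
    rw [abs_div, abs_mul, abs_mul, abs_of_pos hy0, abs_of_nonneg (pow_nonneg ht0.le 2)]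
    calc |κ| * |b| * t ^ 2 / y ≤ |κ| * |b| * (4 / y ^ 2) / y :=
          div_le_div_of_nonneg_right (mul_le_mul_of_nonneg_left ht2 (by positivity)) hy0.le
      _ = 4 * |κ| * |b| * (1 / y ^ 3) := by field_simp
      _ ≤ 4 * |κ| * |b| * W := mul_le_mul_of_nonneg_left hW1 (by positivity)
  -- T5
  have t5 : |κ * E₄ / y| ≤ 4 * |κ| * A * W := by
    rw [abs_div, abs_mul, abs_of_pos hy0]
    have h1 : |κ| * |E₄| / y ≤ |κ| * (8 * A / y ^ 3) / y :=
      div_le_div_of_nonneg_right (mul_le_mul_of_nonneg_left hE₄b (abs_nonneg κ)) hy0.le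
    have h2 : |κ| * (8 * A / y ^ 3) / y ≤ 4 * |κ| * A * (1 / y ^ 3) := by
      rw [show |κ| * (8 * A / y ^ 3) / y = 4 * |κ| * A * (1 / y ^ 3) * (2 / y) by field_simp; ring]
      refine mul_le_of_le_one_right (by positivity) ?_
      rw [div_le_one hy0]; exact hy2
    exact h1.trans (h2.trans (mul_le_mul_of_nonneg_left hW1 (by positivity)))
  -- T6
  have t6 : |κ * u₀ * d| ≤ |κ| * B * D₁ * W := by
    rw [abs_mul, abs_mul]
    calc |κ| * |u₀| * |d| ≤ |κ| * (B * L / y) * (D₁ * L ^ 2 / y ^ 2) :=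
          mul_le_mul (mul_le_mul_of_nonneg_left hu0b (abs_nonneg κ)) hdb (abs_nonneg d) (by positivity)
      _ = |κ| * B * D₁ * W := by rw [hW]; field_simp
  calc |-(κ ^ 2 * d / y) - κ ^ 2 * r / y - κ * a * t * u / y - κ * b * t ^ 2 / y - κ * E₄ / y - κ * u₀ * d|
      ≤ |κ ^ 2 * d / y| + |κ ^ 2 * r / y| + |κ * a * t * u / y| + |κ * b * t ^ 2 / y| + |κ * E₄ / y|
          + |κ * u₀ * d| := by
        have a5 := abs_sub (-(κ ^ 2 * d / y) - κ ^ 2 * r / y - κ * a * t * u / y - κ * b * t ^ 2 / y - κ * E₄ / y)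
          (κ * u₀ * d)
        have a4 := abs_sub (-(κ ^ 2 * d / y) - κ ^ 2 * r / y - κ * a * t * u / y - κ * b * t ^ 2 / y) (κ * E₄ / y)
        have a3 := abs_sub (-(κ ^ 2 * d / y) - κ ^ 2 * r / y - κ * a * t * u / y) (κ * b * t ^ 2 / y)
        have a2 := abs_sub (-(κ ^ 2 * d / y) - κ ^ 2 * r / y) (κ * a * t * u / y)
        have a1 := abs_sub (-(κ ^ 2 * d / y)) (κ ^ 2 * r / y)
        rw [abs_neg] at a1
        linarith
    _ ≤ κ ^ 2 * D₁ * W + 2 * κ ^ 2 * B ^ 2 * W + 2 * |κ| * |a| * B * W + 4 * |κ| * |b| * W + 4 * |κ| * A * W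
          + |κ| * B * D₁ * W := by linarith
    _ = _ := by ring

/-- **Remainder bound, last seven terms** (abstract letters): with `y ≥ 2`, `0 < t ≤ 2∕y`, `1 ≤ L ≤ y`, `B, D₁, A ≥ 0`,
`|u| ≤ BL∕y`, `|d| ≤ D₁L²∕y²`, `|r₃| ≤ 2B³L³∕y³`, `|E₄| ≤ 8A∕y³`:
`|−κd²∕2 − κr₃ − ad∕y − atu² − btu∕y − bt²u − E₄| ≤ (|κ|D₁²∕2 + 2|κ|B³ + |a|D₁ + 2|a|B² + 2|b|B + 4|b|B + 8A)·L³∕y³`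
(the d² term uses L ≤ y: L⁴∕y⁴ ≤ L³∕y³). [folklore] -/
theorem inverse_fourth_remainder_le₂ {t y κ a b u d E₄ r₃ B D₁ A L : ℝ} (hy2 : 2 ≤ y) (ht0 : 0 < t)
    (ht_le : t ≤ 2 / y) (hL1 : 1 ≤ L) (hLy : L ≤ y) (hB0 : 0 ≤ B) (hD0 : 0 ≤ D₁) (hA : 0 ≤ A)
    (hub : |u| ≤ B * L / y) (hdb : |d| ≤ D₁ * L ^ 2 / y ^ 2) (hr₃b : |r₃| ≤ 2 * B ^ 3 * L ^ 3 / y ^ 3)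
    (hE₄b : |E₄| ≤ 8 * A / y ^ 3) :
    |-(κ * d ^ 2 / 2) - κ * r₃ - a * d / y - a * t * u ^ 2 - b * t * u / y - b * t ^ 2 * u - E₄|
      ≤ (|κ| * D₁ ^ 2 / 2 + 2 * |κ| * B ^ 3 + |a| * D₁ + 2 * |a| * B ^ 2 + 2 * |b| * B + 4 * |b| * B + 8 * A)
          * (L ^ 3 / y ^ 3) := by
  have hy0 : 0 < y := by linarith
  have hL0 : 0 < L := by linarith
  have hy3 : (0:ℝ) < y ^ 3 := by positivity
  set W : ℝ := L ^ 3 / y ^ 3 with hW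
  have hW0 : 0 ≤ W := by positivity
  have hL3 : 1 ≤ L ^ 3 := one_le_pow₀ hL1
  have hLL3 : L ≤ L ^ 3 := by nlinarith [hL1, hL3]
  have hL2L3 : L ^ 2 ≤ L ^ 3 := by nlinarith [hL1]
  have hW1 : 1 / y ^ 3 ≤ W := by rw [hW]; exact div_le_div_of_nonneg_right hL3 hy3.le
  have hWL : L / y ^ 3 ≤ W := by rw [hW]; exact div_le_div_of_nonneg_right hLL3 hy3.le
  have hWL2 : L ^ 2 / y ^ 3 ≤ W := by rw [hW]; exact div_le_div_of_nonneg_right hL2L3 hy3.le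
  have hWL4 : L ^ 4 / y ^ 4 ≤ W := by
    rw [hW, div_le_div_iff₀ (by positivity) hy3]
    have : L ^ 4 * y ^ 3 = L ^ 3 * y ^ 3 * L := by ring
    rw [this, show L ^ 3 * y ^ 4 = L ^ 3 * y ^ 3 * y by ring]
    exact mul_le_mul_of_nonneg_left hLy (by positivity)
  have ht2 : t ^ 2 ≤ 4 / y ^ 2 := by
    calc t ^ 2 ≤ (2 / y) ^ 2 := pow_le_pow_left₀ ht0.le ht_le 2
      _ = 4 / y ^ 2 := by rw [div_pow]; norm_num
  have hu2 : u ^ 2 ≤ (B * L / y) ^ 2 := by rw [← sq_abs u]; exact pow_le_pow_left₀ (abs_nonneg _) hub 2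
  -- T7
  have t7 : |κ * d ^ 2 / 2| ≤ |κ| * D₁ ^ 2 / 2 * W := by
    rw [abs_div, abs_mul, abs_of_nonneg (sq_nonneg d), abs_of_pos (by norm_num : (0:ℝ) < 2)]
    have hd2 : d ^ 2 ≤ (D₁ * L ^ 2 / y ^ 2) ^ 2 := by rw [← sq_abs d]; exact pow_le_pow_left₀ (abs_nonneg _) hdb 2
    calc |κ| * d ^ 2 / 2 ≤ |κ| * (D₁ * L ^ 2 / y ^ 2) ^ 2 / 2 :=
          div_le_div_of_nonneg_right (mul_le_mul_of_nonneg_left hd2 (abs_nonneg κ)) (by norm_num)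
      _ = |κ| * D₁ ^ 2 / 2 * (L ^ 4 / y ^ 4) := by field_simp
      _ ≤ |κ| * D₁ ^ 2 / 2 * W := mul_le_mul_of_nonneg_left hWL4 (by positivity)
  -- T8
  have t8 : |κ * r₃| ≤ 2 * |κ| * B ^ 3 * W := by
    rw [abs_mul]
    calc |κ| * |r₃| ≤ |κ| * (2 * B ^ 3 * L ^ 3 / y ^ 3) := mul_le_mul_of_nonneg_left hr₃b (abs_nonneg κ)
      _ = 2 * |κ| * B ^ 3 * W := by rw [hW]; ring
  -- T9
  have t9 : |a * d / y| ≤ |a| * D₁ * W := by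
    rw [abs_div, abs_mul, abs_of_pos hy0]
    calc |a| * |d| / y ≤ |a| * (D₁ * L ^ 2 / y ^ 2) / y :=
          div_le_div_of_nonneg_right (mul_le_mul_of_nonneg_left hdb (abs_nonneg a)) hy0.le
      _ = |a| * D₁ * (L ^ 2 / y ^ 3) := by field_simp
      _ ≤ |a| * D₁ * W := mul_le_mul_of_nonneg_left hWL2 (by positivity)
  -- T10
  have t10 : |a * t * u ^ 2| ≤ 2 * |a| * B ^ 2 * W := by
    rw [abs_mul, abs_mul, abs_of_pos ht0, abs_of_nonneg (sq_nonneg u)]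
    calc |a| * t * u ^ 2 ≤ |a| * (2 / y) * (B * L / y) ^ 2 :=
          mul_le_mul (mul_le_mul_of_nonneg_left ht_le (abs_nonneg a)) hu2 (sq_nonneg u) (by positivity)
      _ = 2 * |a| * B ^ 2 * (L ^ 2 / y ^ 3) := by field_simp
      _ ≤ 2 * |a| * B ^ 2 * W := mul_le_mul_of_nonneg_left hWL2 (by positivity)
  -- T11
  have t11 : |b * t * u / y| ≤ 2 * |b| * B * W := by
    rw [abs_div, abs_mul, abs_mul, abs_of_pos hy0, abs_of_pos ht0]
    calc |b| * t * |u| / y ≤ |b| * (2 / y) * (B * L / y) / y := by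
          refine div_le_div_of_nonneg_right ?_ hy0.le
          exact mul_le_mul (mul_le_mul_of_nonneg_left ht_le (abs_nonneg b)) hub (abs_nonneg u) (by positivity)
      _ = 2 * |b| * B * (L / y ^ 3) := by field_simp
      _ ≤ 2 * |b| * B * W := mul_le_mul_of_nonneg_left hWL (by positivity)
  -- T12
  have t12 : |b * t ^ 2 * u| ≤ 4 * |b| * B * W := by
    rw [abs_mul, abs_mul, abs_of_nonneg (pow_nonneg ht0.le 2)]
    calc |b| * t ^ 2 * |u| ≤ |b| * (4 / y ^ 2) * (B * L / y) :=
          mul_le_mul (mul_le_mul_of_nonneg_left ht2 (abs_nonneg b)) hub (abs_nonneg u) (by positivity)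
      _ = 4 * |b| * B * (L / y ^ 3) := by field_simp
      _ ≤ 4 * |b| * B * W := mul_le_mul_of_nonneg_left hWL (by positivity)
  -- T13
  have t13 : |E₄| ≤ 8 * A * W := hE₄b.trans (by
    calc 8 * A / y ^ 3 = 8 * A * (1 / y ^ 3) := by ring
      _ ≤ 8 * A * W := mul_le_mul_of_nonneg_left hW1 (by positivity))
  calc |-(κ * d ^ 2 / 2) - κ * r₃ - a * d / y - a * t * u ^ 2 - b * t * u / y - b * t ^ 2 * u - E₄|
      ≤ |κ * d ^ 2 / 2| + |κ * r₃| + |a * d / y| + |a * t * u ^ 2| + |b * t * u / y| + |b * t ^ 2 * u| + |E₄| := by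
        have a6 := abs_sub (-(κ * d ^ 2 / 2) - κ * r₃ - a * d / y - a * t * u ^ 2 - b * t * u / y - b * t ^ 2 * u) E₄
        have a5 := abs_sub (-(κ * d ^ 2 / 2) - κ * r₃ - a * d / y - a * t * u ^ 2 - b * t * u / y) (b * t ^ 2 * u)
        have a4 := abs_sub (-(κ * d ^ 2 / 2) - κ * r₃ - a * d / y - a * t * u ^ 2) (b * t * u / y)
        have a3 := abs_sub (-(κ * d ^ 2 / 2) - κ * r₃ - a * d / y) (a * t * u ^ 2)
        have a2 := abs_sub (-(κ * d ^ 2 / 2) - κ * r₃) (a * d / y)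
        have a1 := abs_sub (-(κ * d ^ 2 / 2)) (κ * r₃)
        rw [abs_neg] at a1
        linarith
    _ ≤ |κ| * D₁ ^ 2 / 2 * W + 2 * |κ| * B ^ 3 * W + |a| * D₁ * W + 2 * |a| * B ^ 2 * W + 2 * |b| * B * W
          + 4 * |b| * B * W + 8 * A * W := by linarith
    _ = _ := by ring

end

end Summit.QuantumFields.BalabanUV.Beta.EriceFlowEnclosureInverseLawFourthStep
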